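import Literature.NumberTheory.Rogawski1990.FinExplicitTransferFactorInertPlaceValuation   -- ★ (D2) p839937: `Δ‴_v = (−q)^{log v_w(χ_g(u)_w)} · κ_v`, `valued_apply_eq_one_of_conjLocal_mul_self`
import Literature.NumberTheory.Rogawski1990.LocalStableClassesNonsplitKappa                -- ★ p840169: `finKappaAt_eq_ite_twistGram_eigenframe` (κ in the eigenframe)
import Literature.NumberTheory.Rogawski1990.LocalNormFibreSurjectiveNonsplit               -- ★ p840444: `evalRingHom_placesOver_injective`; ★ p08 `IsLocalNormPair.charpoly_eq`
import HarnessLib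

/-!
# Rogawski's explicit finite transfer factor at an unramified inert place in EIGENVALUE coordinates:
# `Δ‴_v(γ_H, γ′) = (−q)^{−(N₁+N₂)} · κ_v(γ_H, γ′)`, `N_i = ord_w(u′_i − u)` — Flicker's `Δ_{G∕H}(t) = (−q)^{−N₁−N₂}`
(Flicker 1998, pp. 74–75; Rogawski 1990, §4.9 p. 55)

Topic `NumberTheory/Rogawski1990`; namespace `Literature.NumberTheory.Rogawski1990`.  THEOREMS ONLY (no definition, no named fact, no instance, no notation,
no `sorry`; count-neutral for the books).  Cell `pub/hodgecm-mathlib`, F0∕P3a road «D-N7-inert» (the inert unit fundamental lemma, books row #103-ns, COUNT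
programme from [Flicker1998UnitaryFL] — LEAD F0P3a-plan (g9) WORD T8-33 (A), brick **(L7) «TRANSFER-FACTOR VALUE at inert places»**; map of record A-p06 (g26)
MAP v2 §1 (L6), §2 WANT 5).  By import over ★ (D2) `FinExplicitTransferFactorInertPlaceValuation` (the eigenvalue-FREE closed form) and ★ the κ-rider
`LocalStableClassesNonsplitKappa` (κ in the eigenframe).  HONEST LABEL: HC_CM is proved only modulo the printed citations until rung 0 closes; this file proves
no letter.

THE PRINT.  [Flicker1998UnitaryFL, pp. 74–75]: for `t = (a, b, c)` regular in `T = (E¹)³ ⊂ H = U(1,1) × U(1)` (`b` on the `U(1)`-factor), «the transfer factor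
`Δ_{G∕H}(t)` … is `(−q)^{−N₁−N₂}`.  Here `q = #(R∕πR)` … and `a − b ∈ π^{N₁}R_E^×`, `c − b ∈ π^{N₂}R_E^×` define the non-negative integers `N₁, N₂`».
[Rogawski1990, §4.9 p. 55]: `Δ_{G∕H} = τ · D_{G∕H} = (−q)^{−(n₁₂+n₂₃)}` (`μ`, `E∕F` unramified), `n_{ij} = ord(γ_i − γ_j)`, `γ₂ = u` the `U(1)`-eigenvalue — so Flicker's
`N₁ = n₁₂`, `N₂ = n₂₃`, and his one-variable `Δ(t)` is Rogawski's two-variable `Δ(γ_H, γ′)` at the class with `κ = +1`.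

WHAT IS ★ AND WHAT THIS FILE ADDS.  ★ (D2) HEAD `finExplicitDelta_eq_neg_absNorm_zpow_mul_kappa_of_nonsplit_of_isUnramifiedIn`: `Δ‴_v = (−q)^m · κ_v` with the
EIGENVALUE-FREE exponent `m = log v_w(χ_g(u)_w)`, `χ_g(u) = (finCharpolyTwo a).eval (finGammaTwo a)`.  This file is the DICTIONARY to eigenvalues: on a
type-(1) eigenframe `γ′ P = P · diag(u′)` (★ L4a currency: `u′` injective, `u′_j = u`), `charpoly γ′ = Π_i (X − u′_i)` and `charpoly γ′ = χ_g · (X − u)` (★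
`IsLocalNormPair.charpoly_eq`) give `χ_g = Π_{i≠j}(X − u′_i)` (cancel the monic `X − u`), `χ_g(u) = Π_{i≠j}(u − u′_i)` (§1, every finite `v`); at the ONE place
`w` above a non-split `v` the factors are non-zero (`eval_w` injective, ★ `evalRingHom_placesOver_injective`) so `log v_w(χ_g(u)_w) = Σ_{i≠j} log v_w((u′_i − u′_j)_w)
= −(N₁ + N₂)` (§2; `N_i ≥ 0` because norm-one elements are units); hence the HEAD (§3) `Δ‴_v = (−q)^{Σ_{i≠j} log v_w((u′_i−u′_j)_w)} · κ_v`, its SIGNED form with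
κ read on the `j`-th eigenvector length (★ `finKappaAt_eq_ite_twistGram_eigenframe`), FLICKER'S VALUE `(−q)^{−(N₁+N₂)}` at the class whose `j`-th eigenvector
length is a norm (`κ = +1`), and the consistency check «`N₁ = N₂ = 0` (residually regular) ⟹ `Δ‴_v = κ_v`» (★ (D2) §1 is its `κ = 1` instance).
Exponent convention = (D2)'s: Mathlib's `Valued.v ϖ_w = exp(−1)`, so `log v_w((u′_i − u′_j)_w) = −N_i ≤ 0` and `(−q)^{Σ log} = (−q)^{−(N₁+N₂)}` literally.

* §1 (every finite `v`) `charpoly_eq_prod_X_sub_C_of_eigenframe`, `finCharpolyTwo_mul_X_sub_C_eq_prod_of_eigenframe`, `finCharpolyTwo_eq_prod_erase_of_eigenframe`,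
  **`eval_finCharpolyTwo_finGammaTwo_eq_prod_of_eigenframe`**, `sum_erase_eq_add_of_ne` (two-index bookkeeping on `Fin 3`).
* §2 (non-split `v`) `apply_sub_apply_ne_zero_of_injective`, `isUnit_eval_finCharpolyTwo_of_eigenframe`, **`log_valued_eval_finCharpolyTwo_apply_eq_sum`**,
  `log_valued_sub_apply_nonpos` (`N_i ≥ 0`).
* §3 HEAD **`finExplicitDelta_eq_neg_absNorm_zpow_sum_mul_kappa_of_eigenframe`**, **`finExplicitDelta_eq_neg_absNorm_zpow_sum_mul_ite_of_eigenframe`**,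
  **`finExplicitDelta_eq_neg_absNorm_zpow_sum_of_normTest`** (Flicker's `Δ(t)`), `finExplicitDelta_eq_kappa_of_forall_valued_sub_eq_one`.

## References
* [Flicker1998UnitaryFL] Y. Z. Flicker, *Elementary proof of the fundamental lemma for a unitary group*, Canad. J. Math. 50 (1998) 74–98, pp. 74–75 (`Δ_{G∕H}(t) =
  (−q)^{−N₁−N₂}`, `N₁, N₂`).
* [Rogawski1990] J. D. Rogawski, *Automorphic Representations of Unitary Groups in Three Variables*, Ann. of Math. Stud. 123 (1990), §4.9 p. 55 (`τ`, `D_{G∕H}`,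
  Prop. 4.9.1 (b)), §3.5 Prop. 3.5.2 (c) p. 29, §3.6 p. 31 (type (1) tori), §4.3 p. 43.
-/

set_option autoImplicit false

noncomputable section

open NumberField IsDedekindDomain Matrix Polynomial
open scoped MatrixGroups

namespace Literature.NumberTheory.Rogawski1990

open Literature.NumberTheory.Automorphic Literature.NumberTheory.GaloisRepresentations Literature.NumberTheory.QuadraticForms
open Literature.NumberTheory.NumberFields

variable (L : Type) [Field L] [NumberField L] [IsCMField L] (v : HeightOneSpectrum (𝓞 ↥(maximalRealSubfield L)))
  (H' : Matrix (Fin 3) (Fin 3) L)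
  (a : (UnitaryGroup.cmDatum L 2 (Matrix.of fun i j : Fin 2 => if i.val + j.val + 1 = 2 then (1 : L) else 0)).Local v ×
      (UnitaryGroup.cmDatum L 1 (Matrix.of fun i j : Fin 1 => if i.val + j.val + 1 = 1 then (1 : L) else 0)).Local v)
  (b : (UnitaryGroup.cmDatum L 3 H').Local v)

/-! ## §1 The eigenvalue dictionary (every finite place): `χ_g = Π_{i≠j}(X − u′_i)`, `χ_g(u) = Π_{i≠j}(u − u′_i)` -/

section Dictionary

variable {P : GL (Fin 3) (UnitaryGroup.LocalRing L v)} {u' : Fin 3 → UnitaryGroup.LocalRing L v}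

/-- **`charpoly γ′ = Π_i (X − u′_i)`** on an eigenframe `γ′ P = P · diag(u′)` (`γ′ = P diag(u′) P⁻¹`; Mathlib `charpoly_units_conj`, `charpoly_diagonal`).
[cite: Rogawski1990, §3.5 p. 29; §3.6 p. 31] -/
theorem charpoly_eq_prod_X_sub_C_of_eigenframe
    (hP : (b.val.val : Matrix (Fin 3) (Fin 3) (UnitaryGroup.LocalRing L v)) * P.val = P.val * diagonal u') :
    (b.val.val : Matrix (Fin 3) (Fin 3) (UnitaryGroup.LocalRing L v)).charpoly = ∏ i, (X - C (u' i)) := by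
  have hPu : IsUnit P.val.det := by
    have h := P.isUnit
    rwa [Matrix.isUnit_iff_isUnit_det] at h
  have hb : (b.val.val : Matrix (Fin 3) (Fin 3) (UnitaryGroup.LocalRing L v)) =
      P.val * diagonal u' * P.val⁻¹ := by
    rw [← hP, Matrix.mul_assoc, Matrix.mul_nonsing_inv _ hPu, Matrix.mul_one]
  rw [hb, Matrix.charpoly_units_conj, Matrix.charpoly_diagonal]

/-- **`χ_g · (X − u) = Π_i (X − u′_i)`** on a matching pair `ι_v(γ_H) ↔ γ′` with an eigenframe of `γ′` (★ `IsLocalNormPair.charpoly_eq`). [cite: Rogawski1990, §4.3 p. 43; §3.6 p. 31] -/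
theorem finCharpolyTwo_mul_X_sub_C_eq_prod_of_eigenframe (h : IsLocalNormPair L H' v a b)
    (hP : (b.val.val : Matrix (Fin 3) (Fin 3) (UnitaryGroup.LocalRing L v)) * P.val = P.val * diagonal u') :
    finCharpolyTwo L v a * (X - C (finGammaTwo L v a)) = ∏ i, (X - C (u' i)) := by
  rw [← IsLocalNormPair.charpoly_eq L H' v h, charpoly_eq_prod_X_sub_C_of_eigenframe L v H' b hP]

/-- **`χ_g = Π_{i ≠ j}(X − u′_i)`** when the frame passes through the `U(1)`-eigenvalue, `u′_j = u` (cancel the monic factor `X − u`). [cite: Rogawski1990, §4.9 p. 55; §3.6 p. 31] -/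
theorem finCharpolyTwo_eq_prod_erase_of_eigenframe (h : IsLocalNormPair L H' v a b)
    (hP : (b.val.val : Matrix (Fin 3) (Fin 3) (UnitaryGroup.LocalRing L v)) * P.val = P.val * diagonal u') {j : Fin 3}
    (hj : u' j = finGammaTwo L v a) :
    finCharpolyTwo L v a = ∏ i ∈ Finset.univ.erase j, (X - C (u' i)) := by
  have e := finCharpolyTwo_mul_X_sub_C_eq_prod_of_eigenframe L v H' a b h hP
  rw [← Finset.prod_erase_mul Finset.univ (fun i => X - C (u' i)) (Finset.mem_univ j), hj] at e
  exact (monic_X_sub_C (finGammaTwo L v a)).isRegular.right e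

/-- **`χ_g(u) = Π_{i ≠ j}(u − u′_i)`** — the `X`-free form: `(u − γ₁)(u − γ₃)` with `γ₁, γ₃` the other two eigenvalues of `γ′`, i.e. the eigenvalues of the `U(Φ₂)`-part `g`.
[cite: Rogawski1990, §4.9 p. 55] [cite: Flicker1998UnitaryFL, pp. 74–75] -/
theorem eval_finCharpolyTwo_finGammaTwo_eq_prod_of_eigenframe (h : IsLocalNormPair L H' v a b)
    (hP : (b.val.val : Matrix (Fin 3) (Fin 3) (UnitaryGroup.LocalRing L v)) * P.val = P.val * diagonal u') {j : Fin 3}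
    (hj : u' j = finGammaTwo L v a) :
    (finCharpolyTwo L v a).eval (finGammaTwo L v a) = ∏ i ∈ Finset.univ.erase j, (u' j - u' i) := by
  rw [finCharpolyTwo_eq_prod_erase_of_eigenframe L v H' a b h hP hj, Polynomial.eval_prod, ← hj]
  simp only [eval_sub, eval_X, eval_C]

omit [NumberField L] [IsCMField L] in
/-- Two-index bookkeeping on `Fin 3`: for `i₁ ≠ i₂` both `≠ j`, `Σ_{i ≠ j} f i = f i₁ + f i₂` (Flicker's two integers `N₁, N₂`). [cite: Flicker1998UnitaryFL, pp. 74–75] -/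
theorem sum_erase_eq_add_of_ne {M : Type*} [AddCommMonoid M] (f : Fin 3 → M) {j i₁ i₂ : Fin 3} (h₁ : i₁ ≠ j) (h₂ : i₂ ≠ j) (h₁₂ : i₁ ≠ i₂) :
    ∑ i ∈ Finset.univ.erase j, f i = f i₁ + f i₂ := by
  have hs : ({i₁, i₂} : Finset (Fin 3)) = Finset.univ.erase j := by
    apply Finset.eq_of_subset_of_card_le
    · intro i hi
      rcases Finset.mem_insert.1 hi with rfl | hi
      · exact Finset.mem_erase.2 ⟨h₁, Finset.mem_univ _⟩
      · rw [Finset.mem_singleton] at hi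
        subst hi
        exact Finset.mem_erase.2 ⟨h₂, Finset.mem_univ _⟩
    · rw [Finset.card_erase_of_mem (Finset.mem_univ j), Finset.card_univ, Fintype.card_fin, Finset.card_pair h₁₂]
  rw [← hs, Finset.sum_pair h₁₂]

end Dictionary

/-! ## §2 At the one place `w` above a non-split `v`: `log v_w(χ_g(u)_w) = Σ_{i≠j} log v_w((u′_i − u′_j)_w) = −(N₁ + N₂)` -/

section OnePlace

variable (w : UnitaryGroup.PlacesOver L v) (hw : IsCMField.complexConj L • w.1 = w.1)
  {P : GL (Fin 3) (UnitaryGroup.LocalRing L v)} {u' : Fin 3 → UnitaryGroup.LocalRing L v}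

/-- `log` of a finite product of non-zero elements of `ℤₘ₀` is the sum of the `log`s. [folklore] -/
private theorem log_prod_eq_sum_log {ι : Type*} (s : Finset ι) (f : ι → WithZero (Multiplicative ℤ)) (hf : ∀ i ∈ s, f i ≠ 0) :
    WithZero.log (∏ i ∈ s, f i) = ∑ i ∈ s, WithZero.log (f i) := by
  classical
  induction s using Finset.induction_on with
  | empty => simp
  | insert i s hi ih =>
    have hfi : f i ≠ 0 := hf i (Finset.mem_insert_self i s)
    have hfs : ∀ k ∈ s, f k ≠ 0 := fun k hk => hf k (Finset.mem_insert_of_mem hk)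
    rw [Finset.prod_insert hi, Finset.sum_insert hi, WithZero.log_mul hfi (Finset.prod_ne_zero_iff.2 hfs), ih hfs]

include hw in
/-- At a non-split `v` distinct elements of `E_v = Π_{w′∣v} L_{w′}` have distinct `w`-components (`eval_w` is injective, ★ `evalRingHom_placesOver_injective`):
`(u′_i − u′_k)_w ≠ 0` for `i ≠ k` on an injective frame. [cite: Rogawski1990, §3.6 p. 31] -/
theorem apply_sub_apply_ne_zero_of_injective (hu' : Function.Injective u') {i k : Fin 3} (hik : i ≠ k) : (u' i - u' k) w ≠ 0 := by
  intro h0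
  apply hik
  apply hu'
  apply evalRingHom_placesOver_injective L v w hw
  rw [Pi.sub_apply] at h0
  exact sub_eq_zero.1 h0

include hw in
/-- **`χ_g(u)` is a unit** on a matching pair with an injective eigenframe through `u` at a non-split `v` (its `w`-component `Π_{i≠j}(u − u′_i)_w` is non-zero) — so the
HEAD below needs no separate `(G,H)`-regularity binder. [cite: Rogawski1990, §4.9 p. 55; §3.6 p. 31] -/
theorem isUnit_eval_finCharpolyTwo_of_eigenframe (h : IsLocalNormPair L H' v a b)
    (hP : (b.val.val : Matrix (Fin 3) (Fin 3) (UnitaryGroup.LocalRing L v)) * P.val = P.val * diagonal u') (hu' : Function.Injective u')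
    {j : Fin 3} (hj : u' j = finGammaTwo L v a) :
    IsUnit ((finCharpolyTwo L v a).eval (finGammaTwo L v a)) := by
  have hv : Subsingleton (UnitaryGroup.PlacesOver L v) :=
    UnitaryGroup.PlacesOver.subsingleton_of_smul_eq (IsCMField.complexConj L) (IsCMField.complexConj_ne_one L) w hw
  refine isUnit_localRing_of_ne_zero_of_subsingleton L v hv fun h0 => ?_
  have hw0 : ((finCharpolyTwo L v a).eval (finGammaTwo L v a)) w = 0 := by rw [h0]; rfl
  rw [eval_finCharpolyTwo_finGammaTwo_eq_prod_of_eigenframe L v H' a b h hP hj, Finset.prod_apply] at hw0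
  exact Finset.prod_ne_zero_iff.2 (fun i hi => apply_sub_apply_ne_zero_of_injective L v w hw hu' (Finset.ne_of_mem_erase hi).symm) hw0

include hw in
/-- **THE EXPONENT IN EIGENVALUES: `log v_w(χ_g(u)_w) = Σ_{i ≠ j} log v_w((u′_i − u′_j)_w) = −(N₁ + N₂)`** (`N_i = ord_w(u′_i − u)`, Mathlib's `v_w(ϖ_w) = exp(−1)`), on a
matching pair with an injective eigenframe `γ′ P = P · diag(u′)`, `u′_j = u`, at a non-split `v`. [cite: Flicker1998UnitaryFL, pp. 74–75] [cite: Rogawski1990, §4.9 p. 55] -/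
theorem log_valued_eval_finCharpolyTwo_apply_eq_sum (h : IsLocalNormPair L H' v a b)
    (hP : (b.val.val : Matrix (Fin 3) (Fin 3) (UnitaryGroup.LocalRing L v)) * P.val = P.val * diagonal u') (hu' : Function.Injective u')
    {j : Fin 3} (hj : u' j = finGammaTwo L v a) :
    WithZero.log (Valued.v (((finCharpolyTwo L v a).eval (finGammaTwo L v a)) w)) =
      ∑ i ∈ Finset.univ.erase j, WithZero.log (Valued.v ((u' i - u' j) w)) := by
  rw [eval_finCharpolyTwo_finGammaTwo_eq_prod_of_eigenframe L v H' a b h hP hj, Finset.prod_apply, map_prod,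
    log_prod_eq_sum_log _ _ fun i hi =>
      (Valuation.ne_zero_iff _).2 (apply_sub_apply_ne_zero_of_injective L v w hw hu' (Finset.ne_of_mem_erase hi).symm)]
  refine Finset.sum_congr rfl fun i _ => ?_
  rw [Pi.sub_apply, Pi.sub_apply, Valuation.map_sub_swap]

include hw in
/-- **`N_i ≥ 0`**: for NORM-ONE eigenvalues (`σ(u′_i) · u′_i = 1`, so `v_w(u′_i,w) = 1`, ★ `valued_apply_eq_one_of_conjLocal_mul_self`) the differences are integral:
`log v_w((u′_i − u′_k)_w) ≤ 0`. [cite: Flicker1998UnitaryFL, pp. 74–75] -/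
theorem log_valued_sub_apply_nonpos (hu'1 : ∀ i, UnitaryGroup.conjLocal L (IsCMField.complexConj L) v (u' i) * u' i = 1) (i k : Fin 3) :
    WithZero.log (Valued.v ((u' i - u' k) w)) ≤ 0 := by
  by_cases h0 : Valued.v ((u' i - u' k) w) = 0
  · rw [h0, WithZero.log_zero]
  rw [WithZero.log_le_iff_le_exp h0, WithZero.exp_zero, Pi.sub_apply]
  calc Valued.v (u' i w - u' k w) ≤ max (Valued.v (u' i w)) (Valued.v (u' k w)) := Valuation.map_sub _ _ _
    _ = 1 := by
      rw [valued_apply_eq_one_of_conjLocal_mul_self L v w hw (hu'1 i), valued_apply_eq_one_of_conjLocal_mul_self L v w hw (hu'1 k), max_self]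

end OnePlace

/-! ## §3 The HEAD: `Δ‴_v = (−q)^{−(N₁+N₂)} · κ_v` in eigenvalue coordinates; Flicker's `Δ(t)` -/

section Head

variable (w : UnitaryGroup.PlacesOver L v) (hw : IsCMField.complexConj L • w.1 = w.1)
  {P : GL (Fin 3) (UnitaryGroup.LocalRing L v)} {u' : Fin 3 → UnitaryGroup.LocalRing L v}

include hw in
open scoped Classical in
/-- **ROGAWSKI'S TRANSFER FACTOR IN EIGENVALUE COORDINATES: `Δ‴_v(γ_H, γ′) = (−q)^{Σ_{i≠j} log v_w((u′_i − u′_j)_w)} · κ_v(γ_H, γ′) = (−q)^{−(N₁+N₂)} · κ_v`**, `q = #k_v`,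
at a non-split place `v` unramified in `L`, for `μ` unramified at `w` under the N7 μ-guard `μ|_{𝕀_{L⁺}} = ω_{L∕L⁺}`, on a matching pair `ι_v(γ_H) ↔ γ′` with an
injective eigenframe `γ′ P = P · diag(u′)`, `u′_j = u` (type (1): `T ≅ (L_w¹)³`) — ★ (D2) HEAD with §2's exponent.
[cite: Flicker1998UnitaryFL, pp. 74–75] [cite: Rogawski1990, §4.9 p. 55, Prop. 4.9.1 (b); §4.3 p. 43] -/
theorem finExplicitDelta_eq_neg_absNorm_zpow_sum_mul_kappa_of_eigenframe (μ : HeckeCharacter L)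
    (hμω : ∀ x : ideleGroup ↥(maximalRealSubfield L), μ (AdeleRing.ideleBaseChange ↥(maximalRealSubfield L) L x) = quadraticHeckeCharCM L x)
    (hunr : Algebra.IsUnramifiedIn (𝓞 L) v.asIdeal) (hμ : μ.IsUnramifiedAt w.1) (h : IsLocalNormPair L H' v a b)
    (hP : (b.val.val : Matrix (Fin 3) (Fin 3) (UnitaryGroup.LocalRing L v)) * P.val = P.val * diagonal u') (hu' : Function.Injective u')
    {j : Fin 3} (hj : u' j = finGammaTwo L v a) :
    finExplicitDelta L v H' a μ b =
      (-(Ideal.absNorm v.asIdeal : ℂ)) ^ (∑ i ∈ Finset.univ.erase j, WithZero.log (Valued.v ((u' i - u' j) w))) *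
        ((finKappaAt L v H' a b : ℤ) : ℂ) := by
  rw [finExplicitDelta_eq_neg_absNorm_zpow_mul_kappa_of_nonsplit_of_isUnramifiedIn L v H' a b w hw μ hμω hunr hμ h
      (isUnit_eval_finCharpolyTwo_of_eigenframe L v H' a b w hw h hP hu' hj),
    log_valued_eval_finCharpolyTwo_apply_eq_sum L v H' a b w hw h hP hu' hj]

include hw in
open scoped Classical in
/-- **THE SIGNED FORM: `Δ‴_v(γ_H, γ′) = ± (−q)^{−(N₁+N₂)}`, `+` iff the `j`-th eigenvector length `(H′_P)_{jj} = ⟨p_j, p_j⟩_{H′}` is a unit norm** (κ read in the eigenframe,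
★ `finKappaAt_eq_ite_twistGram_eigenframe`; the four classes `ε ∈ (ℤ∕2)³`, `Σε = 0`, of the local stable class carry `κ = (−1)^{ε_j}`).
[cite: Flicker1998UnitaryFL, pp. 74–75] [cite: Rogawski1990, §4.9 p. 55; §3.5 Prop. 3.5.2 (c) p. 29; §4.3 (4.3.2) p. 43] -/
theorem finExplicitDelta_eq_neg_absNorm_zpow_sum_mul_ite_of_eigenframe (μ : HeckeCharacter L)
    (hμω : ∀ x : ideleGroup ↥(maximalRealSubfield L), μ (AdeleRing.ideleBaseChange ↥(maximalRealSubfield L) L x) = quadraticHeckeCharCM L x)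
    (hunr : Algebra.IsUnramifiedIn (𝓞 L) v.asIdeal) (hμ : μ.IsUnramifiedAt w.1) (h : IsLocalNormPair L H' v a b)
    (hP : (b.val.val : Matrix (Fin 3) (Fin 3) (UnitaryGroup.LocalRing L v)) * P.val = P.val * diagonal u') (hu' : Function.Injective u')
    {j : Fin 3} (hj : u' j = finGammaTwo L v a) :
    finExplicitDelta L v H' a μ b =
      (-(Ideal.absNorm v.asIdeal : ℂ)) ^ (∑ i ∈ Finset.univ.erase j, WithZero.log (Valued.v ((u' i - u' j) w))) *
        (if ∃ z : UnitaryGroup.LocalRing L v, IsUnit z ∧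
            twistGram (UnitaryGroup.conjLocal L (IsCMField.complexConj L) v)
                ((UnitaryGroup.adelicForm L 3 H').map (UnitaryGroup.adeleToLocal L v)) P.val j j =
              z * UnitaryGroup.conjLocal L (IsCMField.complexConj L) v z
          then 1 else -1) := by
  have hv : Subsingleton (UnitaryGroup.PlacesOver L v) :=
    UnitaryGroup.PlacesOver.subsingleton_of_smul_eq (IsCMField.complexConj L) (IsCMField.complexConj_ne_one L) w hw
  rw [finExplicitDelta_eq_neg_absNorm_zpow_sum_mul_kappa_of_eigenframe L v H' a b w hw μ hμω hunr hμ h hP hu' hj,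
    finKappaAt_eq_ite_twistGram_eigenframe L v H' a b hv h (isUnit_eval_finCharpolyTwo_of_eigenframe L v H' a b w hw h hP hu' hj) hP hj]
  split_ifs <;> simp

include hw in
open scoped Classical in
/-- **FLICKER'S VALUE `Δ_{G∕H}(t) = (−q)^{−N₁−N₂}`**: at the class whose `j`-th eigenvector length is a unit norm (`κ_v = +1` — e.g. `t` itself in the quasi-split
group), `Δ‴_v(γ_H, γ′) = (−q)^{Σ_{i≠j} log v_w((u′_i − u′_j)_w)}`. [cite: Flicker1998UnitaryFL, pp. 74–75] [cite: Rogawski1990, §4.9 p. 55, Prop. 4.9.1 (b)] -/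
theorem finExplicitDelta_eq_neg_absNorm_zpow_sum_of_normTest (μ : HeckeCharacter L)
    (hμω : ∀ x : ideleGroup ↥(maximalRealSubfield L), μ (AdeleRing.ideleBaseChange ↥(maximalRealSubfield L) L x) = quadraticHeckeCharCM L x)
    (hunr : Algebra.IsUnramifiedIn (𝓞 L) v.asIdeal) (hμ : μ.IsUnramifiedAt w.1) (h : IsLocalNormPair L H' v a b)
    (hP : (b.val.val : Matrix (Fin 3) (Fin 3) (UnitaryGroup.LocalRing L v)) * P.val = P.val * diagonal u') (hu' : Function.Injective u')
    {j : Fin 3} (hj : u' j = finGammaTwo L v a)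
    (hnorm : ∃ z : UnitaryGroup.LocalRing L v, IsUnit z ∧
      twistGram (UnitaryGroup.conjLocal L (IsCMField.complexConj L) v)
          ((UnitaryGroup.adelicForm L 3 H').map (UnitaryGroup.adeleToLocal L v)) P.val j j =
        z * UnitaryGroup.conjLocal L (IsCMField.complexConj L) v z) :
    finExplicitDelta L v H' a μ b =
      (-(Ideal.absNorm v.asIdeal : ℂ)) ^ (∑ i ∈ Finset.univ.erase j, WithZero.log (Valued.v ((u' i - u' j) w))) := by
  rw [finExplicitDelta_eq_neg_absNorm_zpow_sum_mul_ite_of_eigenframe L v H' a b w hw μ hμω hunr hμ h hP hu' hj, if_pos hnorm, mul_one]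

include hw in
open scoped Classical in
/-- **CONSISTENCY WITH THE RESIDUALLY REGULAR STRATUM: `N₁ = N₂ = 0` ⟹ `Δ‴_v = κ_v`** (all `v_w((u′_i − u′_j)_w) = 1`; with ★ `finKappaAt_eq_one_of_integral_nonsplit`
this is ★ (D2) §1 `Δ‴_v = 1`). [cite: Rogawski1990, §4.9 p. 55, Prop. 4.9.1 (b)] [cite: Flicker1998UnitaryFL, pp. 74–75] -/
theorem finExplicitDelta_eq_kappa_of_forall_valued_sub_eq_one (μ : HeckeCharacter L)
    (hμω : ∀ x : ideleGroup ↥(maximalRealSubfield L), μ (AdeleRing.ideleBaseChange ↥(maximalRealSubfield L) L x) = quadraticHeckeCharCM L x)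
    (hunr : Algebra.IsUnramifiedIn (𝓞 L) v.asIdeal) (hμ : μ.IsUnramifiedAt w.1) (h : IsLocalNormPair L H' v a b)
    (hP : (b.val.val : Matrix (Fin 3) (Fin 3) (UnitaryGroup.LocalRing L v)) * P.val = P.val * diagonal u') (hu' : Function.Injective u')
    {j : Fin 3} (hj : u' j = finGammaTwo L v a) (h1 : ∀ i, i ≠ j → Valued.v ((u' i - u' j) w) = 1) :
    finExplicitDelta L v H' a μ b = ((finKappaAt L v H' a b : ℤ) : ℂ) := by
  rw [finExplicitDelta_eq_neg_absNorm_zpow_sum_mul_kappa_of_eigenframe L v H' a b w hw μ hμω hunr hμ h hP hu' hj,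
    Finset.sum_eq_zero (fun i hi => by rw [h1 i (Finset.ne_of_mem_erase hi), WithZero.log_one]), zpow_zero, one_mul]

end Head

end Literature.NumberTheory.Rogawski1990

end
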